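import Summits.BirchSwinnertonDyer.BirchSwinnertonDyer.Theorems.InertBadSignedBranchesInertBadAtThreeIstarZeroOfEtaGZ
import Summits.BirchSwinnertonDyer.BirchSwinnertonDyer.Theorems.InertBadSignedBranchesInertBadAtThreeIstarZeroOddClass
import Summits.BirchSwinnertonDyer.Rank1Residual.Additive.QuadraticBranchPeriodRatioOfManinFact
import HarnessLib

/-!
# Route `InertBadSignedBranches` (rung K8), D71 child `InertBadAtThreeIstarZero`: the period-ratio
# binder `hper` at EVERY ODD prime — in particular at `p = 3` — from Mazur's `p ∤ c₀` alone, and the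
# `p = 3` / odd-`p` class and missing-input nodes WITHOUT the displayed period datum
# (helper toward stmt-BirchSwinnertonDyer-19656; cell `b2b-bsdres`, seat x1b GEN 46, file 131; theorems only)

HONEST FRAMING (cell `b2b-bsdres`, run/shared/lean/b2b/bsd-rank1-residual/, verbatim in every file):
the goal of the cell is to DELETE the COMBINATION-SHAPED residual classes of the Birch–Swinnerton-Dyer
formula for ALL analytic-rank `≤ 1` elliptic curves over `ℚ` — "full BSD formula for every rank `≤ 1`
curve in class `C`" assembled STRICTLY from published theorems — so that the rank-`≤ 1` remainder
becomes exactly the CONSTRUCTION-SHAPED classes, which are TYPED (missing-input `Prop`s), NOT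
attempted. This is not "finishing BSD". Research route; NO CLAIM BEYOND STATED CLASSES; the class
served (O10-PS@3 = X12 ∩ CM-inert ∩ Kodaira `I₀*` at `3`, 57 classes `N < 5·10⁵`; and O10-PS at any
odd `p`) stays CONSTRUCTION-SHAPED and OPEN; nothing here changes a label or a mark. THEOREMS ONLY
(0 definitions, 0 named facts minted, 0 `sorry`): every conclusion is CONDITIONAL on its displayed
hypotheses — the law in pair form / (GZ_η-VAL), (C1_η) and the readings appear ONLY as hypotheses; the
named fact `mazur_not_dvd_maninConstant_of_odd` (Mazur 1978 Cor. 4.1 in lattice form; PRINTED PROOF, not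
formalised) is TAKEN AS A HYPOTHESIS `hM` (conditional result), never asserted.

PARTITION (D-0054): CornerF inert-bad sub-cell (B12 / O10; O10-PS `e = 2`) × ALL rank-one pairs of
signed local type `(p, I₀*)` × `p = 3` (and every odd `p`) — types-the-object-of / none: removes the
displayed period-ratio binder `hper` of the seat bsd-cm-inert's odd-`p` / `p = 3` nodes
(`InertBadOdd.lowerHalfOnType_IstarZero_three_of_pairLaw_of_lowerReading`,
`InertBadOdd.missingInputAt_IstarZero_three_of_pairLaw_of_readings`,
`InertBadOdd.missingInputAt_IstarZero_three_of_etaGZValuation_of_readings` and their `_of_ne_two`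
parents) modulo ONE EXISTING named fact which is already a conjunct of the route's `PublishedFactsInert`;
closes no cell, books nothing, moves no mark.

## Why the `5 ≤ p` guard of x1b's file 130 (`Additive.periodRatio_of_mazur`) is not needed

File 130 took `hper` at `p ≥ 5` from `SkinnerUrban2014.realPeriodRat_eq_unit_mul_plusPeriod_of_mazur` /
`imaginaryPeriodRat_eq_unit_mul_minusPeriod_of_mazur`, whose binder shape (that of the named fact
`realPeriodRat_eq_unit_mul_plusPeriod`) carries `5 ≤ p`. But the PROVED statements one level below,
`SkinnerUrban2014.exists_unit_mul_plusPeriod_of_irreducible_of_mazur` /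
`exists_unit_mul_minusPeriod_of_irreducible_of_mazur`, need only `p ≠ 2`, `E[p]` irreducible and
`p² ∤ N` — and at a GOOD prime with `a_p(V) = 0`, `p ≠ 2`: `V[p]` is irreducible (Serre 1972 §1.11
Prop. 12, tree theorem `hasIrreducibleModPGaloisRep_of_dvd_frobeniusTrace`, binder `p ≠ 2`) and `p ∤ N`
(`SkinnerUrban2014.not_dvd_level_of_hasGoodReductionAtPrime`). So `hper` holds at EVERY odd `p` granted
`hM`, in particular at `p = 3` (`p* = −3`, `η(−1) = −1`: the minus / imaginary period).

## What is here

* §1 `inv_norm_eq_one_and_inv_mul_eq` (bookkeeping: `‖u‖_p = 1 ∧ X = u·Y ⟹ ‖u⁻¹‖_p = 1 ∧ u⁻¹·X = Y`);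
  **`periodRatio_of_mazur_of_ne_two`** — `hper` at every odd `p` from `hM` alone (both parities);
  **`periodRatio_three_of_mazur`** — VERBATIM the `hper` binder of the three `p = 3` nodes above;
  `quadraticBranch_hdata_of_mazur_of_ne_two` — the `hdata` binder (period relation + existence of the
  quadratic-branch minus `L`-function, Kobayashi Thm. 3.2 = Pollack) at every odd `p` from `hM`.
* §2 the `p = 3` nodes of the seat bsd-cm-inert = THE D71 CHILD `InertBadAtThreeIstarZero` / the
  O10-PS@3 class node, with `hper`@3 DISCHARGED by `hM` (NO period datum):
  `lowerHalfOnType_IstarZero_three_of_pairLaw_of_lowerReading_of_mazur`,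
  `missingInputAt_IstarZero_three_of_pairLaw_of_readings_of_mazur`,
  `missingInputAt_IstarZero_three_of_etaGZValuation_of_readings_of_mazur`.
  (The odd-`p` parents `…_of_mazur_of_ne_two` are filed in the sequel
  `InertBadSignedBranchesInertBadAtThreeIstarZeroOddOfMazur.lean`.)
NET (nothing booked; no mark / label / tier / count moves): the `I₀*`-at-3 half of `InertBadAtThree`
reads "kernel modulo C-cc-1@3 (pair form) | (GZ_η-VAL)@3 ∧ (C1_η)@3 ∧ readings ∧ the named facts hmod /
hGZ / hGZK / hPT / hnf / hM" — LITERALLY the input list of the `p ≥ 5` branch of the route's bridge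
(`CMRungInputs.cmInertBad_of_inputs`: `PublishedFactsInert` = hmod ∧ hGZ ∧ hGZK ∧ hPT ∧ hnf ∧ hM), with
no extra datum at `3`.

References (locators only): [Mazur1978] Cor. 4.1; [GreenbergVatsal2000] §3 Rem. 3.4;
[EdixhovenManin1991] Prop. 2, §1; [Serre1972] §1.11 Prop. 12; [Kobayashi2003] Thm. 3.2 (p. 7), §4
(p. 8), Thm. 7.4 (p. 13); [Miller2011LMS] §1, Def. 1.1; [SilvermanATAEC1994] IV.9.4, Table 4.1.
-/

set_option autoImplicit false
set_option linter.dupNamespace false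

noncomputable section

open scoped Classical MatrixGroups ModularForm NumberField

open CongruenceSubgroup Field NumberField IsDedekindDomain IsDedekindDomain.HeightOneSpectrum
  WeierstrassCurve Rat.HeightOneSpectrum
open Literature.NumberTheory.EllipticCurves
open Literature.NumberTheory.EllipticCurves.ModularForms
open Literature.NumberTheory.EllipticCurves.Kobayashi2003 hiding IsQuadraticBranchMinusLFunction
open Literature.NumberTheory.EllipticCurves.Rank1Residual
open Literature.NumberTheory.EllipticCurves.Rank1Residual.Typed
open Literature.NumberTheory.GaloisRepresentations
open Literature.NumberTheory.GaloisCohomology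
open Summit.BirchSwinnertonDyer.Rank1Residual
open Summit.BirchSwinnertonDyer.Rank1Residual.Additive
open Summit.BirchSwinnertonDyer.Rank1Residual.Additive.LocalLog
open Summit.BirchSwinnertonDyer.Rank1Residual.X12.O10
open Summit.BirchSwinnertonDyer.BirchSwinnertonDyer.Theorems.EtaGZ

namespace Summit.BirchSwinnertonDyer.BirchSwinnertonDyer.Theorems.InertBadOdd

/-! ## §1 The period-ratio binder `hper` at EVERY ODD prime from Mazur's `p ∤ c₀` -/

section PeriodRatio

variable (p : ℕ) [hp : Fact p.Prime]

/-- Bookkeeping: a `p`-adic unit `u ∈ ℚ` with `X = u·Y` gives the `p`-adic unit `ϖ = u⁻¹` with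
`ϖ·X = Y` (the shape in which the chain's `hper` / `hdata` binders display the period relation).
[cite: GreenbergVatsal2000, §3, Remark 3.4] -/
theorem inv_norm_eq_one_and_inv_mul_eq {u : ℚ} {X Y : ℝ} (hu : ‖(u : ℚ_[p])‖ = 1)
    (hXY : X = u * Y) : ‖((u⁻¹ : ℚ) : ℚ_[p])‖ = 1 ∧ ((u⁻¹ : ℚ) : ℝ) * X = Y := by
  have hu0 : u ≠ 0 := by
    rintro rfl
    rw [Rat.cast_zero, norm_zero] at hu
    exact zero_ne_one hu
  refine ⟨by rw [Rat.cast_inv, norm_inv, hu, inv_one], ?_⟩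
  rw [hXY, Rat.cast_inv, inv_mul_cancel_left₀ (Rat.cast_ne_zero.mpr hu0)]

/-- **`∃ ϖ ∈ ℚ`, `‖ϖ‖_p = 1`, with `ϖ·Ω(V) = Ω⁺_f` (`p ≡ 1 (mod 4)`) resp. `ϖ·|Ω⁻(V)| = Ω⁻_f`
(`p ≡ 3 (mod 4)`) for every globally minimal `V/ℚ` with GOOD reduction at an ODD prime `p` and
`a_p(V) = 0`, from Mazur's `p ∤ c₀` ALONE** (`hM : mazur_not_dvd_maninConstant_of_odd`): `V[p]` is
irreducible at an odd good prime with `p ∣ a_p` (Serre 1972 §1.11 Prop. 12,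
`hasIrreducibleModPGaloisRep_of_dvd_frobeniusTrace`), `p ∤ N` (good reduction, Atkin–Lehner), so the
proofs-file theorems `SkinnerUrban2014.exists_unit_mul_plusPeriod_of_irreducible_of_mazur` /
`exists_unit_mul_minusPeriod_of_irreducible_of_mazur` apply; `ϖ = u⁻¹`. The UNIT form (`‖ϖ‖_p = 1`).
CONDITIONAL on `hM`; nothing booked. [cite: Mazur1978, Cor. 4.1] [cite: GreenbergVatsal2000, §3, Remark 3.4]
[cite: Serre1972, §1.11 Prop. 12] -/
theorem exists_padicNorm_eq_one_periodRatio_of_mazur_of_ne_two (hM : mazur_not_dvd_maninConstant_of_odd)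
    (hp2 : p ≠ 2) (V : WeierstrassCurve ℚ) [V.IsElliptic] [V.IsGloballyMinimal]
    {N : ℕ} [NeZero N] (f : CuspForm (Gamma0 N) 2) (hf : IsNewformOf V f)
    (hgood : V.HasGoodReductionAtPrime p) (hap : V.frobeniusTrace p = 0) :
    ∃ ϖ : ℚ, ‖(ϖ : ℚ_[p])‖ = 1 ∧
      (if Even (p / 2) then (ϖ : ℝ) * V.realPeriodRat = plusPeriod f
        else (ϖ : ℝ) * V.imaginaryPeriodRat = minusPeriod f) := by
  have hirr : V.HasIrreducibleModPGaloisRep p :=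
    hasIrreducibleModPGaloisRep_of_dvd_frobeniusTrace V p hp2
      (V.not_dvd_minimalDiscriminantInt_of_hasGoodReductionAtPrime' p hgood)
      (by rw [hap]; exact dvd_zero _)
  have hpN : ¬ p ^ 2 ∣ N := fun h ↦
    SkinnerUrban2014.not_dvd_level_of_hasGoodReductionAtPrime hgood hf
      (dvd_trans (dvd_pow_self p two_ne_zero) h)
  by_cases heven : Even (p / 2)
  · obtain ⟨u, hu, hΩ⟩ :=
      SkinnerUrban2014.exists_unit_mul_plusPeriod_of_irreducible_of_mazur hM V p hp2 hirr f hf hpN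
    obtain ⟨h1, h2⟩ := inv_norm_eq_one_and_inv_mul_eq p hu hΩ
    exact ⟨u⁻¹, h1, by rw [if_pos heven]; exact h2⟩
  · obtain ⟨u, hu, hΩ⟩ :=
      SkinnerUrban2014.exists_unit_mul_minusPeriod_of_irreducible_of_mazur hM V p hp2 hirr f hf hpN
    obtain ⟨h1, h2⟩ := inv_norm_eq_one_and_inv_mul_eq p hu hΩ
    exact ⟨u⁻¹, h1, by rw [if_neg heven]; exact h2⟩

/-- **The binder `hper` at EVERY ODD prime `p` from Mazur's `p ∤ c₀` ALONE** — x1b's file 130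
`Additive.periodRatio_of_mazur` WITHOUT its `5 ≤ p` guard (the guard was an artefact of the binder
shape of the named fact `realPeriodRat_eq_unit_mul_plusPeriod`; the proofs-file theorems below it need
only `p ≠ 2`). CONDITIONAL on `hM`; nothing booked. [cite: Mazur1978, Cor. 4.1]
[cite: GreenbergVatsal2000, §3, Remark 3.4] [cite: Serre1972, §1.11 Prop. 12] -/
theorem periodRatio_of_mazur_of_ne_two (hM : mazur_not_dvd_maninConstant_of_odd) (hp2 : p ≠ 2) :
    ∀ (V : WeierstrassCurve ℚ) [V.IsElliptic] [V.IsGloballyMinimal]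
      {N : ℕ} [NeZero N] (f : CuspForm (Gamma0 N) 2), IsNewformOf V f →
      V.HasGoodReductionAtPrime p → V.frobeniusTrace p = 0 →
      ∃ ϖ : ℚ, ‖(ϖ : ℚ_[p])‖ ≤ 1 ∧
        (if Even (p / 2) then (ϖ : ℝ) * V.realPeriodRat = plusPeriod f
          else (ϖ : ℝ) * V.imaginaryPeriodRat = minusPeriod f) := by
  intro V _ _ N _ f hf hgood hap
  obtain ⟨ϖ, hϖ, hrel⟩ :=
    exists_padicNorm_eq_one_periodRatio_of_mazur_of_ne_two p hM hp2 V f hf hgood hap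
  exact ⟨ϖ, hϖ.le, hrel⟩

/-- **The binder `hper` AT `p = 3` VERBATIM** (the shape displayed by the seat bsd-cm-inert's `p = 3`
nodes: `p* = −3`, `Even (3/2)` is false, so the minus / imaginary period): for every globally minimal
`V/ℚ` with good reduction at `3` and `a_3(V) = 0`, `∃ ϖ ∈ ℚ`, `‖ϖ‖_3 ≤ 1`, `ϖ·|Ω⁻(V)| = Ω⁻_f` —
from Mazur's `3 ∤ c₀` ALONE. CONDITIONAL on `hM`; nothing booked. [cite: Mazur1978, Cor. 4.1]
[cite: GreenbergVatsal2000, §3, Remark 3.4] [cite: Serre1972, §1.11 Prop. 12] -/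
theorem periodRatio_three_of_mazur [h3 : Fact (Nat.Prime 3)]
    (hM : mazur_not_dvd_maninConstant_of_odd) :
    ∀ (V : WeierstrassCurve ℚ) [V.IsElliptic] [V.IsGloballyMinimal]
      {N : ℕ} [NeZero N] (f : CuspForm (Gamma0 N) 2), IsNewformOf V f →
      V.HasGoodReductionAtPrime 3 → V.frobeniusTrace 3 = 0 →
      ∃ ϖ : ℚ, ‖(ϖ : ℚ_[3])‖ ≤ 1 ∧ (ϖ : ℝ) * V.imaginaryPeriodRat = minusPeriod f := by
  have hodd : ¬ Even (3 / 2) := by decide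
  intro V _ _ N _ f hf hgood hap
  obtain ⟨ϖ, hϖ, hrel⟩ := periodRatio_of_mazur_of_ne_two 3 hM (by decide) V f hf hgood hap
  exact ⟨ϖ, hϖ, by rw [if_neg hodd] at hrel; exact hrel⟩

/-- **The binder `hdata` (period relation + a quadratic-branch minus `L`-function, Kobayashi Thm. 3.2
= Pollack) at EVERY ODD prime from Mazur's `p ∤ c₀` alone** — x1b's file 130
`Additive.quadraticBranch_hdata_of_mazur` without its `5 ≤ p` guard (§1 ∘
`Additive.quadraticBranch_hdata_of_periodRatio`, whose own binder is `p ≠ 2`). CONDITIONAL on `hM`;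
nothing booked. [cite: Mazur1978, Cor. 4.1] [cite: Kobayashi2003, Thm. 3.2, (3.5) and (3.7) (p. 7)]
[cite: Pollack2003, Thm. 5.6 and Prop. 6.18] -/
theorem quadraticBranch_hdata_of_mazur_of_ne_two (hM : mazur_not_dvd_maninConstant_of_odd)
    (hp2 : p ≠ 2) :
    ∀ (V : WeierstrassCurve ℚ) [V.IsElliptic] [V.IsGloballyMinimal]
      {N : ℕ} [NeZero N] (f : CuspForm (Gamma0 N) 2), IsNewformOf V f →
      V.HasGoodReductionAtPrime p → V.frobeniusTrace p = 0 →
      ∃ ϖ : ℚ, (if Even (p / 2) then (ϖ : ℝ) * V.realPeriodRat = plusPeriod f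
          else (ϖ : ℝ) * V.imaginaryPeriodRat = minusPeriod f) ∧
        ∃ L : IwasawaAlgebra p, IsQuadraticBranchMinusLFunction f p ϖ L :=
  quadraticBranch_hdata_of_periodRatio hp2 (periodRatio_of_mazur_of_ne_two p hM hp2)

end PeriodRatio

/-! ## §2 `p = 3`: the O10-PS@3 class node and the D71 child `InertBadAtThreeIstarZero` with NO period datum -/

section Three

variable [h3 : Fact (Nat.Prime 3)]

/-- **THE `p = 3` CLASS NODE FOR `I₀*` AT `3` (O10-PS@3, 57 classes `N < 5·10⁵`), `LowerHalfOnType 3 I₀*`,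
with NO period datum**: `InertBadOdd.lowerHalfOnType_IstarZero_three_of_pairLaw_of_lowerReading` with
`hper`@3 DISCHARGED by `periodRatio_three_of_mazur`. Inputs: the law in pair form on the type at `3`,
(C1_η)@3 on the CM good-inert curves, named facts hmod / hGZ / hGZK / hPT / hnf / hM, the lower
Kobayashi-7.4 reading at `3`. I.e. EXACTLY the input list of the `p ≥ 5` class node of record
(`X12.O10.lowerHalfOnType_IstarZero_of_valuation_of_lowerReading_of_mazur`). CONDITIONAL on every
displayed hypothesis; the `III/III*`-at-3 half of `InertBadAtThree` untouched; nothing booked.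
[cite: Mazur1978, Cor. 4.1] [cite: Kobayashi2003, §4 (p. 8), Thm. 7.4 (p. 13)]
[cite: SilvermanATAEC1994, IV.9.4 and Table 4.1] [cite: Miller2011LMS, Def. 1.1] -/
theorem lowerHalfOnType_IstarZero_three_of_pairLaw_of_lowerReading_of_mazur
    (hmod : hasEntireLFunction_rat) (hGZ : GrossZagier1986_thm_I_7_3)
    (hGZK : rank_eq_analyticRank_of_analyticRank_le_one)
    (hPT : poitouTate_selmerStructure_duality_real ℚ) (hnf : exists_isNewformOf)
    (hM : mazur_not_dvd_maninConstant_of_odd)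
    (hlaw : ∀ (W : WeierstrassCurve ℚ) [W.IsElliptic] [W.IsGloballyMinimal],
      HasSignedLocalType W 3 (.Istar 0) → W.analyticRank = 1 →
      ∀ (V : WeierstrassCurve ℚ) [V.IsElliptic] [V.IsGloballyMinimal] (C : VariableChange ℚ)
        {N : ℕ} [NeZero N] {f : CuspForm (Gamma0 N) 2},
        C • W.quadraticTwist (-3) = V →
        V.HasGoodReductionAtPrime 3 → V.frobeniusTrace 3 = 0 → IsNewformOf V f →
        ∀ (ϖ : ℚ), (ϖ : ℝ) * V.imaginaryPeriodRat = minusPeriod f →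
        ∀ (L : IwasawaAlgebra 3), IsQuadraticBranchMinusLFunction f 3 ϖ L →
        (∀ Q : (W.baseChange ℚ_[3]).toAffine.Point, 3 • Q = 0 → Q = 0) →
        ∀ (P : W.toAffine.Point) (n : ℕ), ¬ IsOfFinAddOrder P →
        (∀ R : W.toAffine.Point, ∃ (k : ℤ) (T : W.toAffine.Point), IsOfFinAddOrder T ∧ R = k • P + T) →
        (∃ Q : (W.baseChange ℚ_[3]).toAffine.Point, 3 ^ n • Q = W.toPadicPoint 3 P) →
        (∀ Q : (W.baseChange ℚ_[3]).toAffine.Point, 3 ^ (n + 1) • Q ≠ W.toPadicPoint 3 P) →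
        ∀ (q : ℚ), shaAn W = (q : ℂ) →
        PowerSeries.coeff 1 L ≠ 0 ∧
          ((PowerSeries.coeff 1 L : ℤ_[3]) : ℚ_[3]).valuation =
            2 * (n : ℤ) + padicValRat 3 (q * W.tamagawaProduct / (W.torsionOrder : ℚ) ^ 2))
    (h74l : ∀ (W : WeierstrassCurve ℚ) [W.IsElliptic] [W.IsGloballyMinimal],
      HasSignedLocalType W 3 (.Istar 0) → W.analyticRank = 1 →
      ∀ (V : WeierstrassCurve ℚ) [V.IsElliptic] [V.IsGloballyMinimal] (C : VariableChange ℚ)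
        {N : ℕ} [NeZero N] {f : CuspForm (Gamma0 N) 2},
        (3 : ℕ) ≠ 2 → C • W.quadraticTwist (-3) = V →
        V.HasGoodReductionAtPrime 3 → V.frobeniusTrace 3 = 0 →
        QuadraticBranchPlusMainConjectureAt V 3 → IsNewformOf V f →
        ∀ (ϖ : ℚ), (ϖ : ℝ) * V.imaginaryPeriodRat = minusPeriod f →
        ∀ (Lη : IwasawaAlgebra 3), IsQuadraticBranchMinusLFunction f 3 ϖ Lη →
        ∀ (κ : ZpExtension ℚ 3) (γ : Field.absoluteGaloisGroup ℚ),
          κ.IsCyclotomic → κ.IsTopGenerator γ → IsCyclotomicVariable 3 γ →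
        ∀ (D : StrictSignedSelmerDualData W κ ℚ_[3] γ (-1)) (L' : IwasawaAlgebra 3),
          Lη = PowerSeries.X * L' → D.charIdeal ≤ Ideal.span {L'})
    (hC1 : ∀ (V : WeierstrassCurve ℚ) [V.IsElliptic] [V.IsGloballyMinimal], V.HasCM →
      V.HasGoodReductionAtPrime 3 → CMInert V 3 → QuadraticBranchPlusMainConjectureAt V 3) :
    LowerHalfOnType 3 (.Istar 0) :=
  lowerHalfOnType_IstarZero_three_of_pairLaw_of_lowerReading hmod hGZ hGZK hPT hnf
    (periodRatio_three_of_mazur hM) hlaw h74l hC1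

/-- **THE D71 CHILD `InertBadAtThreeIstarZero` MODULO C-cc-1@3 (pair form) ∧ (C1_η)@3 ∧ readings ∧ the
named facts hmod / hGZ / hGZK / hPT / hnf / hM — NO period datum**:
`InertBadOdd.missingInputAt_IstarZero_three_of_pairLaw_of_readings` with `hper`@3 DISCHARGED by
`periodRatio_three_of_mazur`. For every globally minimal `W` of signed local type `(3, I₀*)` with
`r_an(W) = 1`, `Typed.X12.MissingInputAt W 3`. What stays displayed is LITERALLY the input list of the
`p ≥ 5` branch of the route's bridge `CMRungInputs.cmInertBad_of_inputs` (C-cc-1 there in typed form).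
CONDITIONAL; nothing booked; the `III/III*`-at-3 child untouched. [cite: Mazur1978, Cor. 4.1]
[cite: Kobayashi2003, §4 (p. 8), Thm. 7.4 (p. 13)] [cite: KitajimaOtsuki2018, Main Thm. 1.3 (arXiv:1607.03612 p. 3)]
[cite: SilvermanATAEC1994, IV.9.4 and Table 4.1] [cite: Miller2011LMS, §1 and Def. 1.1] -/
theorem missingInputAt_IstarZero_three_of_pairLaw_of_readings_of_mazur
    (hmod : hasEntireLFunction_rat) (hGZ : GrossZagier1986_thm_I_7_3)
    (hGZK : rank_eq_analyticRank_of_analyticRank_le_one)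
    (hPT : poitouTate_selmerStructure_duality_real ℚ) (hnf : exists_isNewformOf)
    (hM : mazur_not_dvd_maninConstant_of_odd)
    (hlaw : ∀ (W : WeierstrassCurve ℚ) [W.IsElliptic] [W.IsGloballyMinimal],
      HasSignedLocalType W 3 (.Istar 0) → W.analyticRank = 1 →
      ∀ (V : WeierstrassCurve ℚ) [V.IsElliptic] [V.IsGloballyMinimal] (C : VariableChange ℚ)
        {N : ℕ} [NeZero N] {f : CuspForm (Gamma0 N) 2},
        C • W.quadraticTwist (-3) = V →
        V.HasGoodReductionAtPrime 3 → V.frobeniusTrace 3 = 0 → IsNewformOf V f →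
        ∀ (ϖ : ℚ), (ϖ : ℝ) * V.imaginaryPeriodRat = minusPeriod f →
        ∀ (L : IwasawaAlgebra 3), IsQuadraticBranchMinusLFunction f 3 ϖ L →
        (∀ Q : (W.baseChange ℚ_[3]).toAffine.Point, 3 • Q = 0 → Q = 0) →
        ∀ (P : W.toAffine.Point) (n : ℕ), ¬ IsOfFinAddOrder P →
        (∀ R : W.toAffine.Point, ∃ (k : ℤ) (T : W.toAffine.Point), IsOfFinAddOrder T ∧ R = k • P + T) →
        (∃ Q : (W.baseChange ℚ_[3]).toAffine.Point, 3 ^ n • Q = W.toPadicPoint 3 P) →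
        (∀ Q : (W.baseChange ℚ_[3]).toAffine.Point, 3 ^ (n + 1) • Q ≠ W.toPadicPoint 3 P) →
        ∀ (q : ℚ), shaAn W = (q : ℂ) →
        PowerSeries.coeff 1 L ≠ 0 ∧
          ((PowerSeries.coeff 1 L : ℤ_[3]) : ℚ_[3]).valuation =
            2 * (n : ℤ) + padicValRat 3 (q * W.tamagawaProduct / (W.torsionOrder : ℚ) ^ 2))
    (hRd : ∀ (W : WeierstrassCurve ℚ) [W.IsElliptic] [W.IsGloballyMinimal],
      HasSignedLocalType W 3 (.Istar 0) → W.analyticRank = 1 →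
      OddBranchStrictMinusNoFiniteSubmoduleAt W 3 ∧
      ∀ (V : WeierstrassCurve ℚ) [V.IsElliptic] [V.IsGloballyMinimal] (C : VariableChange ℚ)
        {N : ℕ} [NeZero N] {f : CuspForm (Gamma0 N) 2},
        (3 : ℕ) ≠ 2 → C • W.quadraticTwist (-3) = V →
        V.HasGoodReductionAtPrime 3 → V.frobeniusTrace 3 = 0 →
        QuadraticBranchPlusMainConjectureAt V 3 → IsNewformOf V f →
        ∀ (ϖ : ℚ), (ϖ : ℝ) * V.imaginaryPeriodRat = minusPeriod f →
        ∀ (Lη : IwasawaAlgebra 3), IsQuadraticBranchMinusLFunction f 3 ϖ Lη →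
        ∀ (κ : ZpExtension ℚ 3) (γ : Field.absoluteGaloisGroup ℚ),
          κ.IsCyclotomic → κ.IsTopGenerator γ → IsCyclotomicVariable 3 γ →
        ∀ (D : StrictSignedSelmerDualData W κ ℚ_[3] γ (-1)) (L' : IwasawaAlgebra 3),
          Lη = PowerSeries.X * L' → D.charIdeal = Ideal.span {L'})
    (hC1 : ∀ (V : WeierstrassCurve ℚ) [V.IsElliptic] [V.IsGloballyMinimal], V.HasCM →
      V.HasGoodReductionAtPrime 3 → CMInert V 3 → QuadraticBranchPlusMainConjectureAt V 3) :
    ∀ (W : WeierstrassCurve ℚ) [W.IsElliptic] [W.IsGloballyMinimal],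
      HasSignedLocalType W 3 (.Istar 0) → W.analyticRank = 1 → X12.MissingInputAt W 3 :=
  missingInputAt_IstarZero_three_of_pairLaw_of_readings hmod hGZ hGZK hPT hnf
    (periodRatio_three_of_mazur hM) hlaw hRd hC1

/-- **THE D71 CHILD `InertBadAtThreeIstarZero` MODULO (GZ_η-VAL)@3 ∧ (C1_η)@3 ∧ readings ∧ the named
facts hmod / hGZ / hGZK / hPT / hnf / hM — NO period datum**:
`InertBadOdd.missingInputAt_IstarZero_three_of_etaGZValuation_of_readings` with `hper`@3 DISCHARGED
by `periodRatio_three_of_mazur`. For every globally minimal `W` of signed local type `(3, I₀*)` with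
`r_an(W) = 1`, `Typed.X12.MissingInputAt W 3`. CONDITIONAL ((GZ_η-VAL)@3 is the cell's own statement,
PAPER from (GZ_η)@3, a hypothesis here); nothing booked; the `III/III*`-at-3 child untouched.
[cite: Mazur1978, Cor. 4.1] [cite: Kobayashi2003, §4 (p. 8), Thm. 7.4 (p. 13)]
[cite: SilvermanATAEC1994, IV.9.4 and Table 4.1] [cite: Miller2011LMS, §1 and Def. 1.1] -/
theorem missingInputAt_IstarZero_three_of_etaGZValuation_of_readings_of_mazur
    (hmod : hasEntireLFunction_rat) (hGZfact : GrossZagier1986_thm_I_7_3)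
    (hGZK : rank_eq_analyticRank_of_analyticRank_le_one)
    (hPT : poitouTate_selmerStructure_duality_real ℚ) (hnf : exists_isNewformOf)
    (hM : mazur_not_dvd_maninConstant_of_odd)
    (hGZ : ∀ (W : WeierstrassCurve ℚ) [W.IsElliptic] [W.IsGloballyMinimal],
      HasSignedLocalType W 3 (.Istar 0) → W.analyticRank = 1 →
      ∀ (V : WeierstrassCurve ℚ) [V.IsElliptic] [V.IsGloballyMinimal] (C : VariableChange ℚ)
        {N : ℕ} [NeZero N] {f : CuspForm (Gamma0 N) 2},
        C • W.quadraticTwist (-3) = V →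
        V.HasGoodReductionAtPrime 3 → V.frobeniusTrace 3 = 0 → IsNewformOf V f →
        ∀ (ϖ : ℚ), (ϖ : ℝ) * V.imaginaryPeriodRat = minusPeriod f →
        ∀ (L : IwasawaAlgebra 3), IsQuadraticBranchMinusLFunction f 3 ϖ L →
        ∀ (P : W.toAffine.Point), ¬ IsOfFinAddOrder P →
        (∀ R : W.toAffine.Point, ∃ (k : ℤ) (T : W.toAffine.Point), IsOfFinAddOrder T ∧ R = k • P + T) →
        ∀ (q : ℚ), W.leadingLCoeff / ((W.realPeriodRat * W.regulator : ℝ) : ℂ) = (q : ℂ) →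
        PowerSeries.coeff 1 L ≠ 0 ∧
          ((PowerSeries.coeff 1 L : ℤ_[3]) : ℚ_[3]).valuation =
            2 * (padicLog (W.baseChange ℚ_[3]) (W.toPadicPoint 3 P)).valuation + padicValRat 3 q)
    (hRd : ∀ (W : WeierstrassCurve ℚ) [W.IsElliptic] [W.IsGloballyMinimal],
      HasSignedLocalType W 3 (.Istar 0) → W.analyticRank = 1 →
      OddBranchStrictMinusNoFiniteSubmoduleAt W 3 ∧
      ∀ (V : WeierstrassCurve ℚ) [V.IsElliptic] [V.IsGloballyMinimal] (C : VariableChange ℚ)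
        {N : ℕ} [NeZero N] {f : CuspForm (Gamma0 N) 2},
        (3 : ℕ) ≠ 2 → C • W.quadraticTwist (-3) = V →
        V.HasGoodReductionAtPrime 3 → V.frobeniusTrace 3 = 0 →
        QuadraticBranchPlusMainConjectureAt V 3 → IsNewformOf V f →
        ∀ (ϖ : ℚ), (ϖ : ℝ) * V.imaginaryPeriodRat = minusPeriod f →
        ∀ (Lη : IwasawaAlgebra 3), IsQuadraticBranchMinusLFunction f 3 ϖ Lη →
        ∀ (κ : ZpExtension ℚ 3) (γ : Field.absoluteGaloisGroup ℚ),
          κ.IsCyclotomic → κ.IsTopGenerator γ → IsCyclotomicVariable 3 γ →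
        ∀ (D : StrictSignedSelmerDualData W κ ℚ_[3] γ (-1)) (L' : IwasawaAlgebra 3),
          Lη = PowerSeries.X * L' → D.charIdeal = Ideal.span {L'})
    (hC1 : ∀ (V : WeierstrassCurve ℚ) [V.IsElliptic] [V.IsGloballyMinimal], V.HasCM →
      V.HasGoodReductionAtPrime 3 → CMInert V 3 → QuadraticBranchPlusMainConjectureAt V 3) :
    ∀ (W : WeierstrassCurve ℚ) [W.IsElliptic] [W.IsGloballyMinimal],
      HasSignedLocalType W 3 (.Istar 0) → W.analyticRank = 1 → X12.MissingInputAt W 3 :=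
  missingInputAt_IstarZero_three_of_etaGZValuation_of_readings hmod hGZfact hGZK hPT hnf
    (periodRatio_three_of_mazur hM) hGZ hRd hC1

end Three

end Summit.BirchSwinnertonDyer.BirchSwinnertonDyer.Theorems.InertBadOdd

end
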